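import Literature.NumberTheory.ConnesConsani2023.ZetaCyclesFiniteSections
import Literature.NumberTheory.LFunctions.YoshidaWindowFourierSeries
import Literature.NumberTheory.LFunctions.YoshidaWindowSpacesProofs
import Literature.NumberTheory.LFunctions.WeilExplicitContinuous
import Mathlib.Analysis.SpecialFunctions.JapaneseBracket
import HarnessLib

/-!
# `ZetaCyclesSemilocalForm`: Lemma 2.2 — the Laurent polynomials `ℂ[U, U⁻¹]` are a core for `QW_λ`

RH-FREE (label, line 1).  Third proof file of
`Literature/NumberTheory/ConnesConsani2023/ZetaCyclesSemilocalForm.lean` (Connes–Consani, *Spectral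
triples and ζ-cycles*, Enseign. Math. **69** (2023) 93–148 = arXiv:2106.01715
[cite: ConnesConsani2023, Lemma 2.2 p. 104 and its proof pp. 104–105, eqs. (2.14)–(2.19)]).
Everything is PROVED; no definition, no named fact.  The one theorem of record is
`lemma_2_2_holds : lemma_2_2` — the named fact `lemma_2_2` (Lemma 2.2 in the REDUCED FORM (2.16) to
which the printed proof reduces it: for every `ξ` in the form domain of the window `[−a, a]`,
`a = log λ > 0`, and every `ε > 0` there is `η ∈ E_N = Yoshida1992.W a N` with
`‖ξ̂ − η̂‖₁² = ∫ |ξ̂(s) − η̂(s)|² (1 + log(1 + s²)) ds < ε`) becomes a tree theorem.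

## The printed proof (p. 105) and how it is followed here

Additive variable `x ∈ [−a, a]` (the paper writes `L = 2a`, `U(x) = e^{2πix/L} = e^{iπx/a}`);
`ξ̂(s) := weilMellin ξ (1/2 + is) = ∫ ξ(x) e^{isx} dx` is the plain additive Fourier transform on the
critical line, and `‖·‖₁² = logSobolevEnergy`.  The three printed steps, in the printed order:

* §C = (2.17) **dilation** `ξ₁(x) := ρ ξ(ρx)`, `ρ > 1`: `supp ξ₁ ⊆ [−a/ρ, a/ρ]`, `ξ̂₁(s) = ξ̂(s/ρ)`, and
  `‖ξ̂ − ξ̂₁‖₁ → 0` as `ρ → 1` ("the scaling action … is pointwise norm continuous": printed via uniform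
  boundedness `1 + log(1 + ρ²t²) ≤ 2(1 + log(1 + t²))` near `ρ = 1` plus continuity on a dense
  subspace; here the same uniform bound feeds the equivalent route *pointwise convergence + convergence
  of the norms ⇒ norm convergence* (Fatou on `2|f|² + 2|f_ρ|² − |f − f_ρ|² ≥ 0`), which avoids a density
  theorem for the weighted space).
* §D = (2.18) **mollification** `η_n := φ_n ∗ ξ₁` with the tree's mollifiers `WeilContinuous.moll n`:
  `η̂_n = φ̂_n · ξ̂₁` (tree `weilMellin_weilConv_half_line`), `|φ̂_n| ≤ 1`, `φ̂_n → 1` pointwise, so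
  `‖ξ̂₁ − η̂_n‖₁ → 0` by dominated convergence; `η_n ∈ C_c^∞((−a, a))`, i.e. `η_n ∈ Yoshida1992.C a`.
* §B = (2.19) **Fourier truncation** of `η ∈ C_c^∞` on the window: `η = Σ a_k U^k` with `(a_k)` of rapid
  decay (tree `Yoshida1992.summable_pow_mul_norm_fourierCoeff`, pointwise inversion
  `hasSum_fourierCoeff_mul_cexp`), and the truncations `proj a N η ∈ W a N` satisfy
  `‖η̂ − (proj_N η)^‖₁ → 0`.  The print bounds `‖Û^k‖₁² = O(log|k|)` term by term; here the tail
  `η − proj_N η = 1_{[−a,a]} · (η − p_N)` is bounded at once by ONE partial integration on the window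
  (the tree's Yoshida decay estimate, made quantitative: `|φ̂(½+it)|²(1+t²) ≤ (2a S₀)² + (2S₀ + 2a S₁)²`
  with `S₀, S₁` the sup norms of `η − p_N` and of its derivative on the window, both tails of absolutely
  convergent series, hence `→ 0`), against the fixed integrable weight `(1 + log(1+t²))/(1+t²)`.
* §E assembles (2.17)–(2.19) with `‖f + g‖₁² ≤ 2‖f‖₁² + 2‖g‖₁²` (§A).

Tree inputs cited by name (never restated): the window/Fourier dictionary of
`ZetaCyclesSemilocalFormProofs` / `ZetaCyclesFiniteSections` (t9: `integrable_of_memLp_window`,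
`continuous_weilMellin_half_line_of_integrable`, `weilMellin_sub_window`, `mem_formDomain_of_mem_W`, …),
Yoshida's window spaces `C(a) ⊆ K(a)`, `χ_n`, `W a N`, `proj` (`YoshidaWindowSpaces*`,
`YoshidaWindowFourierSeries/Decay`) and the mollifiers of `WeilExplicitContinuous`.
Nothing here bears on the truth of the Riemann hypothesis: a core lemma for a quadratic form fixes
nothing about its sign.
-/

noncomputable section

open Complex Filter Set MeasureTheory
open scoped Real Topology ENNReal ComplexConjugate Convolution Interval

namespace Literature.NumberTheory.ConnesConsani2023

open Literature.NumberTheory.LFunctions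

/-! ## §A The weighted norm `‖·‖₁² = logSobolevEnergy`: weight bounds and the parallelogram bound -/

section Weight

variable {a : ℝ}

/-- The log weight is non-negative. [cite: ConnesConsani2023, proof of Lemma 2.2, the weight 1 + log(1+s²) of (2.16), p. 105 (arXiv chunk p0007:L24)] -/
private theorem logW_nonneg (t : ℝ) : 0 ≤ 1 + Real.log (1 + t ^ 2) := by
  have := Real.log_nonneg (show (1 : ℝ) ≤ 1 + t ^ 2 by nlinarith [sq_nonneg t])
  linarith

/-- The log weight is `≥ 1`. [cite: ConnesConsani2023, proof of Lemma 2.2, the weight 1 + log(1+s²) of (2.16), p. 105 (arXiv chunk p0007:L24)] -/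
private theorem one_le_logW (t : ℝ) : 1 ≤ 1 + Real.log (1 + t ^ 2) := by
  have := Real.log_nonneg (show (1 : ℝ) ≤ 1 + t ^ 2 by nlinarith [sq_nonneg t])
  linarith

/-- The log weight is measurable. [cite: ConnesConsani2023, proof of Lemma 2.2, the weight of (2.16), p. 105 (arXiv chunk p0007:L24)] -/
private theorem measurable_logW : Measurable fun t : ℝ ↦ 1 + Real.log (1 + t ^ 2) :=
  measurable_const.add ((measurable_const.add (measurable_id.pow_const 2)).log)

/-- The log weight is continuous. [cite: ConnesConsani2023, proof of Lemma 2.2, the weight of (2.16), p. 105 (arXiv chunk p0007:L24)] -/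
private theorem continuous_logW : Continuous fun t : ℝ ↦ 1 + Real.log (1 + t ^ 2) := by
  refine continuous_const.add (Continuous.log (by fun_prop) fun t ↦ ?_)
  positivity

/-- **Uniform boundedness of the scaling action near `ρ = 1`** (p. 105: "`(1 + log(1 + ρ²t²)) ≤
2(1 + log(1 + t²))` for all `t ∈ ℝ` for `ρ ≤ 2`"; here with the cruder constant `4`, from
`1 + ρ²t² ≤ 4(1 + t²)` and `log 4 ≤ 3`). [cite: ConnesConsani2023, proof of Lemma 2.2 (2.17), p. 105 (arXiv chunk p0007:L48–L52)] -/
private theorem logW_mul_le {ρ : ℝ} (hρ0 : 0 ≤ ρ) (hρ : ρ ≤ 2) (t : ℝ) :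
    1 + Real.log (1 + (ρ * t) ^ 2) ≤ 4 * (1 + Real.log (1 + t ^ 2)) := by
  have ht : (0 : ℝ) < 1 + t ^ 2 := by nlinarith [sq_nonneg t]
  have h1 : 1 + (ρ * t) ^ 2 ≤ 4 * (1 + t ^ 2) := by
    have : ρ ^ 2 ≤ 4 := by nlinarith
    nlinarith [sq_nonneg t, sq_nonneg ρ, mul_nonneg (sq_nonneg ρ) (sq_nonneg t)]
  have h2 : Real.log (1 + (ρ * t) ^ 2) ≤ Real.log 4 + Real.log (1 + t ^ 2) := by
    rw [← Real.log_mul (by norm_num) ht.ne']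
    exact Real.log_le_log (by nlinarith [sq_nonneg (ρ * t)]) h1
  have h3 : Real.log 4 ≤ 3 := by
    have := Real.log_le_sub_one_of_pos (show (0 : ℝ) < 4 by norm_num)
    linarith
  have h4 := Real.log_nonneg (show (1 : ℝ) ≤ 1 + t ^ 2 by nlinarith [sq_nonneg t])
  linarith

/-- `1 + log(1 + t²) ≤ 5 (1 + t²)^{1/4}` (`log y ≤ y − 1` at `y = (1+t²)^{1/4}`). [folklore] -/
private theorem logW_le_rpow (t : ℝ) :
    1 + Real.log (1 + t ^ 2) ≤ 5 * (1 + t ^ 2) ^ ((1 : ℝ) / 4) := by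
  have h1 : (1 : ℝ) ≤ 1 + t ^ 2 := by nlinarith [sq_nonneg t]
  set y : ℝ := (1 + t ^ 2) ^ ((1 : ℝ) / 4) with hy
  have hy1 : 1 ≤ y := Real.one_le_rpow h1 (by norm_num)
  have hlog : Real.log (1 + t ^ 2) = 4 * Real.log y := by
    rw [hy, Real.log_rpow (by positivity)]
    ring
  have hly : Real.log y ≤ y - 1 := Real.log_le_sub_one_of_pos (by positivity)
  rw [hlog]
  linarith

/-- The fixed integrable weight of the truncation step: `(1 + log(1+t²))/(1+t²) ≤ 5 (1+t²)^{-3/4}`.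
[cite: ConnesConsani2023, proof of Lemma 2.2 (2.19), p. 105 (arXiv chunk p0007:L60–L66)] -/
private theorem logW_div_le (t : ℝ) :
    (1 + Real.log (1 + t ^ 2)) / (1 + t ^ 2) ≤ 5 * (1 + ‖t‖ ^ 2) ^ (-(3 / 2 : ℝ) / 2) := by
  have ht : (0 : ℝ) < 1 + t ^ 2 := by nlinarith [sq_nonneg t]
  rw [Real.norm_eq_abs, sq_abs, div_le_iff₀ ht]
  have e : (1 + t ^ 2) ^ (-(3 / 2 : ℝ) / 2) * (1 + t ^ 2) = (1 + t ^ 2) ^ ((1 : ℝ) / 4) := by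
    rw [show -(3 / 2 : ℝ) / 2 = (1 : ℝ) / 4 - 1 by norm_num, Real.rpow_sub_one ht.ne']
    field_simp
  calc 1 + Real.log (1 + t ^ 2) ≤ 5 * (1 + t ^ 2) ^ ((1 : ℝ) / 4) := logW_le_rpow t
    _ = 5 * (1 + t ^ 2) ^ (-(3 / 2 : ℝ) / 2) * (1 + t ^ 2) := by rw [mul_assoc, e]

/-- `∫ (1 + log(1+t²))/(1+t²) dt < ∞` (as a lower Lebesgue integral). [cite: ConnesConsani2023, proof of Lemma 2.2 (2.19) (‖Û^k‖₁² < ∞), p. 105 (arXiv chunk p0007:L60–L66)] -/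
private theorem lintegral_logW_div_lt_top :
    ∫⁻ t : ℝ, ENNReal.ofReal ((1 + Real.log (1 + t ^ 2)) / (1 + t ^ 2)) < ∞ := by
  have hint : Integrable fun t : ℝ ↦ 5 * (1 + ‖t‖ ^ 2) ^ (-(3 / 2 : ℝ) / 2) :=
    (integrable_rpow_neg_one_add_norm_sq (E := ℝ) (μ := volume)
      (by rw [Module.finrank_self]; norm_num)).const_mul 5
  calc ∫⁻ t : ℝ, ENNReal.ofReal ((1 + Real.log (1 + t ^ 2)) / (1 + t ^ 2))
      ≤ ∫⁻ t : ℝ, ENNReal.ofReal (5 * (1 + ‖t‖ ^ 2) ^ (-(3 / 2 : ℝ) / 2)) :=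
        lintegral_mono fun t ↦ ENNReal.ofReal_le_ofReal (logW_div_le t)
    _ < ∞ := hint.lintegral_lt_top

/-- **The parallelogram bound for the weighted norm**: `‖f̂ − ĝ‖₁² ≤ 2‖f̂‖₁² + 2‖ĝ‖₁²` for window
functions (`|x − y|² ≤ 2|x|² + 2|y|²` under the integral; linearity of `weilMellin` on the window).
[cite: ConnesConsani2023, proof of Lemma 2.2 (the norm ‖·‖₁ of the Hilbert space of (2.17)), p. 105 (arXiv chunk p0007:L43–L47)] -/
theorem logSobolevEnergy_sub_le {f g : ℝ → ℂ} (hf : MemLp f 2 volume)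
    (hfs : Function.support f ⊆ Icc (-a) a) (hg : MemLp g 2 volume)
    (hgs : Function.support g ⊆ Icc (-a) a) :
    logSobolevEnergy (f - g) ≤ 2 * logSobolevEnergy f + 2 * logSobolevEnergy g := by
  have hf1 := integrable_of_memLp_window hf hfs
  have hmeas : AEMeasurable (fun s : ℝ ↦ 2 * ENNReal.ofReal
      (‖weilMellin f (1 / 2 + s * I)‖ ^ 2 * (1 + Real.log (1 + s ^ 2)))) volume := by
    refine (Measurable.ennreal_ofReal ?_).aemeasurable.const_mul _
    exact ((continuous_weilMellin_half_line_of_integrable hf1).norm.pow 2).measurable.mul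
      measurable_logW
  unfold logSobolevEnergy
  rw [← lintegral_const_mul' _ _ (by norm_num), ← lintegral_const_mul' _ _ (by norm_num),
    ← lintegral_add_left' hmeas]
  refine lintegral_mono fun s ↦ ?_
  have hw := logW_nonneg s
  rw [show f - g = fun t ↦ f t - g t from rfl, weilMellin_sub_window hf hfs hg hgs,
    show (2 : ℝ≥0∞) = ENNReal.ofReal 2 by norm_num,
    ← ENNReal.ofReal_mul zero_le_two, ← ENNReal.ofReal_mul zero_le_two,
    ← ENNReal.ofReal_add (by positivity) (by positivity)]
  refine ENNReal.ofReal_le_ofReal ?_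
  set x := weilMellin f (1 / 2 + s * I)
  set y := weilMellin g (1 / 2 + s * I)
  have h1 : ‖x - y‖ ≤ ‖x‖ + ‖y‖ := norm_sub_le x y
  have h2 : ‖x - y‖ ^ 2 ≤ 2 * ‖x‖ ^ 2 + 2 * ‖y‖ ^ 2 := by
    nlinarith [norm_nonneg (x - y), norm_nonneg x, norm_nonneg y, sq_nonneg (‖x‖ - ‖y‖)]
  nlinarith

/-- The energy is symmetric: `‖(−f)^‖₁ = ‖f̂‖₁`, so `‖(g − f)^‖₁ = ‖(f − g)^‖₁` (a local `Pi.sub` form of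
`ZetaCyclesCoreConsequences.logSobolevEnergy_sub_comm`). [cite: ConnesConsani2023, proof of Lemma 2.2 (‖·‖₁ is a norm), p. 105 (arXiv chunk p0007:L43)] -/
private theorem logSobolevEnergy_sub_symm (f g : ℝ → ℂ) :
    logSobolevEnergy (f - g) = logSobolevEnergy (g - f) := by
  have e : f - g = fun x ↦ (-1 : ℂ) * (g - f) x := by
    funext x; simp
  rw [e, logSobolevEnergy_const_mul]
  simp

end Weight

/-! ## §B Step (2.19): Fourier truncation of a smooth function supported inside the window -/

section Truncation

variable {a : ℝ}

/-- The derivative of a test function supported in `[−a, a]` is again one. [cite: ConnesConsani2023, proof of Lemma 2.2 (2.19): η_n ∈ C_c^∞((−L/2, L/2)) is a smooth function on the circle, p. 105 (arXiv chunk p0007:L56–L58)] -/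
theorem deriv_mem_C {ψ : ℝ → ℂ} (hψ : ψ ∈ Yoshida1992.C a) : deriv ψ ∈ Yoshida1992.C a := by
  rw [Yoshida1992.mem_C] at hψ ⊢
  exact ⟨⟨(contDiff_infty_iff_deriv.mp hψ.1.1).2, hψ.1.2.deriv⟩,
    tsupport_deriv_subset.trans hψ.2⟩

/-- **Fourier coefficients of the derivative**: for a test function `ψ` supported in `[−a, a]` (so
`ψ(±a) = 0`), `c_n(ψ′) = (iπn/a) c_n(ψ)` (one partial integration, no boundary term).
[cite: ConnesConsani2023, proof of Lemma 2.2 (2.19): η_n = Σ a_k U^k with (a_k) of rapid decay, p. 105 (arXiv chunk p0007:L56–L58)] -/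
theorem fourierCoeff_deriv_of_mem_C (ha : 0 < a) {ψ : ℝ → ℂ} (hψ : ψ ∈ Yoshida1992.C a) (n : ℤ) :
    Yoshida1992.fourierCoeff a n (deriv ψ) = (π * I * n / a) * Yoshida1992.fourierCoeff a n ψ := by
  rw [Yoshida1992.mem_C] at hψ
  have hsm := hψ.1.1
  have hcont : Continuous ψ := hsm.continuous
  set c : ℂ := -(π * I * n / a) with hc
  have hexp : ∀ x : ℝ, cexp (-(π * I * n * x / a)) = cexp (c * x) := fun x ↦ by
    rw [hc]; congr 1; ring
  unfold Yoshida1992.fourierCoeff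
  simp_rw [hexp]
  -- `e(x) = e^{cx}` has derivative `c e^{cx}`
  have he : ∀ x : ℝ, HasDerivAt (fun y : ℝ ↦ cexp (c * y)) (c * cexp (c * x)) x := by
    intro x
    have h1 : HasDerivAt (fun y : ℝ ↦ c * (y : ℂ)) (c * 1) x :=
      (hasDerivAt_id x).ofReal_comp.const_mul c
    exact h1.cexp.congr_deriv (by rw [mul_one, mul_comm])
  have hψd : ∀ x : ℝ, HasDerivAt ψ (deriv ψ x) x := fun x ↦
    ((hsm.differentiable (by simp)).differentiableAt).hasDerivAt
  have hψ'c : Continuous (deriv ψ) := hsm.continuous_deriv (by simp)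
  have hec : Continuous fun y : ℝ ↦ c * cexp (c * y) := by fun_prop
  -- `∫ e · ψ′ = [e ψ] − ∫ (c e) ψ` and `ψ(±a) = 0`
  have hparts := intervalIntegral.integral_mul_deriv_eq_deriv_mul (a := -a) (b := a)
    (u := fun y : ℝ ↦ cexp (c * y)) (u' := fun y : ℝ ↦ c * cexp (c * y)) (v := ψ) (v' := deriv ψ)
    (fun x _ ↦ he x) (fun x _ ↦ hψd x) (hec.intervalIntegrable _ _) (hψ'c.intervalIntegrable _ _)
  have hψa : ψ a = 0 := Yoshida1992.eq_zero_of_le_abs hcont hψ.2 (by rw [abs_of_pos ha])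
  have hψna : ψ (-a) = 0 :=
    Yoshida1992.eq_zero_of_le_abs hcont hψ.2 (by rw [abs_neg, abs_of_pos ha])
  rw [hψa, hψna, mul_zero, mul_zero, sub_zero, zero_sub] at hparts
  calc ∫ x in (-a)..a, deriv ψ x * cexp (c * x)
      = ∫ x in (-a)..a, cexp (c * x) * deriv ψ x := by
        refine intervalIntegral.integral_congr fun x _ ↦ ?_; ring
    _ = -∫ x in (-a)..a, c * cexp (c * x) * ψ x := hparts
    _ = (π * I * n / a) * ∫ x in (-a)..a, ψ x * cexp (c * x) := by
        rw [← intervalIntegral.integral_neg, ← intervalIntegral.integral_const_mul]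
        refine intervalIntegral.integral_congr fun x _ ↦ ?_
        rw [hc]; ring

/-- The formal derivative of the truncated Fourier series of `ψ` IS the truncated Fourier series of
`ψ′` (coefficientwise `c_n(ψ′) = (iπn/a)c_n(ψ)`). [cite: ConnesConsani2023, proof of Lemma 2.2 (2.19), p. 105 (arXiv chunk p0007:L56–L66)] -/
theorem trigPolyDeriv_eq_trigPoly_deriv (ha : 0 < a) {ψ : ℝ → ℂ} (hψ : ψ ∈ Yoshida1992.C a)
    (N : ℕ) (x : ℝ) :
    Yoshida1992.trigPolyDeriv a N ψ x = Yoshida1992.trigPoly a N (deriv ψ) x := by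
  unfold Yoshida1992.trigPolyDeriv Yoshida1992.trigPoly
  refine Finset.sum_congr rfl fun n _ ↦ ?_
  rw [fourierCoeff_deriv_of_mem_C ha hψ n]
  ring

/-- **One partial integration on the window, quantitative form** (the tree's
`Yoshida1992.exists_norm_sq_weilMellin_mul_le` with its constants made explicit): for
`φ = 1_{[−a,a]} · g` with `g ∈ C¹(ℝ)`, `|g| ≤ S₀` and `|g′| ≤ S₁` on the window,
`|φ̂(½+it)|² (1 + t²) ≤ (2a S₀)² + (2 S₀ + 2a S₁)²` for all real `t`
(`|φ̂| ≤ 2a S₀` and `|t||φ̂| ≤ 2 S₀ + 2a S₁`, the boundary terms being kept).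
[cite: Yoshida1992HermitianForms, §3 p. 289–290, (3.1) (one partial integration); used for ConnesConsani2023 Lemma 2.2 (2.19), p. 105] -/
theorem norm_sq_weilMellin_indicator_mul_le (ha : 0 < a) {g g' : ℝ → ℂ}
    (hg : ∀ x, HasDerivAt g (g' x) x) (hg'c : Continuous g') {S₀ S₁ : ℝ}
    (h0 : ∀ x ∈ Icc (-a) a, ‖g x‖ ≤ S₀) (h1 : ∀ x ∈ Icc (-a) a, ‖g' x‖ ≤ S₁) (t : ℝ) :
    ‖weilMellin ((Icc (-a) a).indicator g) (1 / 2 + t * I)‖ ^ 2 * (1 + t ^ 2) ≤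
      (S₀ * (2 * a)) ^ 2 + (S₀ + S₀ + S₁ * (2 * a)) ^ 2 := by
  have h0mem : (0 : ℝ) ∈ Icc (-a) a := ⟨by linarith, ha.le⟩
  have hamem : a ∈ Icc (-a) a := ⟨by linarith, le_rfl⟩
  have hnamem : -a ∈ Icc (-a) a := ⟨le_rfl, by linarith⟩
  have hS₀0 : 0 ≤ S₀ := (norm_nonneg _).trans (h0 0 h0mem)
  have hS₁0 : 0 ≤ S₁ := (norm_nonneg _).trans (h1 0 h0mem)
  set C₀ : ℝ := S₀ * (2 * a) with hC₀
  set C₁ : ℝ := S₀ + S₀ + S₁ * (2 * a) with hC₁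
  have huIoc : ∀ x ∈ Ι (-a) a, x ∈ Icc (-a) a := fun x hx ↦ by
    rw [uIoc_of_le (by linarith)] at hx; exact ⟨hx.1.le, hx.2⟩
  set c : ℂ := t * I with hc
  have hexp : ∀ x : ℝ, ‖cexp (c * x)‖ = 1 := fun x ↦ by
    rw [hc, show (t : ℂ) * I * x = ((t * x : ℝ) : ℂ) * I by push_cast; ring,
      Complex.norm_exp_ofReal_mul_I]
  have hcn : ‖c‖ = |t| := by
    rw [hc, norm_mul, Complex.norm_I, mul_one, Complex.norm_real, Real.norm_eq_abs]
  have hrepr : weilMellin ((Icc (-a) a).indicator g) (1 / 2 + t * I) =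
      ∫ x in (-a)..a, g x * cexp (c * x) :=
    Yoshida1992.weilMellin_half_line_eq_intervalIntegral ha rfl t
  -- bound 0: `‖φ̂‖ ≤ C₀`
  have hb0 : ‖weilMellin ((Icc (-a) a).indicator g) (1 / 2 + t * I)‖ ≤ C₀ := by
    rw [hrepr]
    have h := intervalIntegral.norm_integral_le_of_norm_le_const (a := -a) (b := a) (C := S₀)
      (f := fun x ↦ g x * cexp (c * x)) fun x hx ↦ by
        rw [norm_mul, hexp, mul_one]; exact h0 x (huIoc x hx)
    rw [show a - -a = 2 * a by ring, abs_of_pos (by positivity : (0 : ℝ) < 2 * a)] at h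
    exact h
  -- bound 1: `|t| ‖φ̂‖ ≤ C₁` (one partial integration)
  have hb1 : |t| * ‖weilMellin ((Icc (-a) a).indicator g) (1 / 2 + t * I)‖ ≤ C₁ := by
    rcases eq_or_ne t 0 with ht | ht
    · rw [ht, abs_zero, zero_mul]; positivity
    have hcne : c ≠ 0 := by
      rw [hc]; exact mul_ne_zero (by exact_mod_cast ht) I_ne_zero
    have htpos : 0 < |t| := abs_pos.2 ht
    have hv : ∀ x : ℝ, HasDerivAt (fun y : ℝ ↦ c⁻¹ * cexp (c * y)) (cexp (c * x)) x := by
      intro x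
      have h1' : HasDerivAt (fun y : ℝ ↦ c * (y : ℂ)) (c * 1) x :=
        (hasDerivAt_id x).ofReal_comp.const_mul c
      have h2 := (h1'.cexp).const_mul c⁻¹
      refine h2.congr_deriv ?_
      rw [mul_one, mul_comm (cexp _) c, ← mul_assoc, inv_mul_cancel₀ hcne, one_mul]
    have hvc : Continuous fun y : ℝ ↦ cexp (c * y) := by fun_prop
    have hparts := intervalIntegral.integral_mul_deriv_eq_deriv_mul (a := -a) (b := a)
      (u := g) (u' := g') (v := fun y : ℝ ↦ c⁻¹ * cexp (c * y)) (v' := fun y : ℝ ↦ cexp (c * y))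
      (fun x _ ↦ hg x) (fun x _ ↦ hv x) (hg'c.intervalIntegrable _ _) (hvc.intervalIntegrable _ _)
    rw [hrepr, hparts]
    have hT1 : ‖g a * (c⁻¹ * cexp (c * (a : ℝ)))‖ ≤ S₀ * |t|⁻¹ := by
      rw [norm_mul, norm_mul, norm_inv, hcn, hexp, mul_one]
      exact mul_le_mul_of_nonneg_right (h0 a hamem) (by positivity)
    have hT2 : ‖g (-a) * (c⁻¹ * cexp (c * ((-a : ℝ) : ℂ)))‖ ≤ S₀ * |t|⁻¹ := by
      rw [norm_mul, norm_mul, norm_inv, hcn, hexp, mul_one]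
      exact mul_le_mul_of_nonneg_right (h0 (-a) hnamem) (by positivity)
    have hT3 : ‖∫ x in (-a)..a, g' x * (c⁻¹ * cexp (c * x))‖ ≤ S₁ * |t|⁻¹ * (2 * a) := by
      have h := intervalIntegral.norm_integral_le_of_norm_le_const (a := -a) (b := a)
        (C := S₁ * |t|⁻¹) (f := fun x ↦ g' x * (c⁻¹ * cexp (c * x))) fun x hx ↦ by
          rw [norm_mul, norm_mul, norm_inv, hcn, hexp, mul_one]
          exact mul_le_mul_of_nonneg_right (h1 x (huIoc x hx)) (by positivity)
      rw [show a - -a = 2 * a by ring, abs_of_pos (by positivity : (0 : ℝ) < 2 * a)] at h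
      exact h
    have hsum : ‖g a * (c⁻¹ * cexp (c * (a : ℝ))) - g (-a) * (c⁻¹ * cexp (c * ((-a : ℝ) : ℂ))) -
        ∫ x in (-a)..a, g' x * (c⁻¹ * cexp (c * x))‖ ≤
        S₀ * |t|⁻¹ + S₀ * |t|⁻¹ + S₁ * |t|⁻¹ * (2 * a) :=
      (norm_sub_le _ _).trans (add_le_add ((norm_sub_le _ _).trans (add_le_add hT1 hT2)) hT3)
    calc |t| * ‖g a * (c⁻¹ * cexp (c * (a : ℝ))) - g (-a) * (c⁻¹ * cexp (c * ((-a : ℝ) : ℂ))) -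
          ∫ x in (-a)..a, g' x * (c⁻¹ * cexp (c * x))‖
        ≤ |t| * (S₀ * |t|⁻¹ + S₀ * |t|⁻¹ + S₁ * |t|⁻¹ * (2 * a)) :=
          mul_le_mul_of_nonneg_left hsum htpos.le
      _ = C₁ := by rw [hC₁]; field_simp
  have hn : 0 ≤ ‖weilMellin ((Icc (-a) a).indicator g) (1 / 2 + t * I)‖ := norm_nonneg _
  have h0' : ‖weilMellin ((Icc (-a) a).indicator g) (1 / 2 + t * I)‖ ^ 2 ≤ C₀ ^ 2 :=
    pow_le_pow_left₀ hn hb0 2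
  have h1' : t ^ 2 * ‖weilMellin ((Icc (-a) a).indicator g) (1 / 2 + t * I)‖ ^ 2 ≤ C₁ ^ 2 := by
    have := pow_le_pow_left₀ (by positivity) hb1 2
    rw [mul_pow, sq_abs] at this
    exact this
  nlinarith

/-- The truncation error of `ψ ∈ C(a)` is the windowed smooth function `1_{[−a,a]} · (ψ − p_N)`.
[cite: ConnesConsani2023, proof of Lemma 2.2 (2.19): η − Σ_{−N}^{N} a_k U^k, p. 105 (arXiv chunk p0007:L62–L66)] -/
theorem sub_proj_eq_indicator (ha : 0 < a) {ψ : ℝ → ℂ} (hψ : ψ ∈ Yoshida1992.C a) (N : ℕ) :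
    ψ - Yoshida1992.proj a N ψ =
      (Icc (-a) a).indicator (fun x ↦ ψ x - Yoshida1992.trigPoly a N ψ x) := by
  rw [Yoshida1992.mem_C] at hψ
  funext x
  by_cases hx : x ∈ Icc (-a) a
  · rw [Pi.sub_apply, Yoshida1992.proj_apply_of_mem ha N ψ hx, indicator_of_mem hx]
  · rw [Pi.sub_apply, Yoshida1992.proj_apply_of_not_mem ha N ψ hx, indicator_of_notMem hx,
      sub_zero]
    refine Yoshida1992.eq_zero_of_le_abs hψ.1.1.continuous hψ.2 ?_
    rw [mem_Icc, not_and_or, not_le, not_le] at hx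
    rcases hx with h | h
    · rw [abs_of_neg (by linarith)]; linarith
    · rw [abs_of_pos (by linarith)]; linarith

/-- **Step (2.19)**: for `ψ ∈ C_c^∞` supported in the window, the truncated Fourier series
`proj a N ψ = Σ_{|k| ≤ N} a_k U^k ∈ E_N` approximate `ψ` in the weighted norm:
`‖ψ̂ − (proj_N ψ)^‖₁² → 0`, so for every `δ > 0` some truncation is `δ`-close.
[cite: ConnesConsani2023, proof of Lemma 2.2, eq. (2.19) «quadratsemi6», p. 105 (arXiv chunk p0007:L56–L67)] -/
theorem exists_logSobolevEnergy_sub_proj_lt (ha : 0 < a) {ψ : ℝ → ℂ} (hψ : ψ ∈ Yoshida1992.C a)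
    {δ : ℝ≥0∞} (hδ : 0 < δ) :
    ∃ N : ℕ, logSobolevEnergy (ψ - Yoshida1992.proj a N ψ) < δ := by
  have hK : ψ ∈ Yoshida1992.K a := Yoshida1992.C_le_K ha hψ
  have hψ' : deriv ψ ∈ Yoshida1992.C a := deriv_mem_C hψ
  have hK' : deriv ψ ∈ Yoshida1992.K a := Yoshida1992.C_le_K ha hψ'
  have hψC := hψ
  rw [Yoshida1992.mem_C] at hψ
  have hsm := hψ.1.1
  -- the two tails
  set T : ℕ → ℝ := fun N ↦ ∑' n : {n // n ∉ Yoshida1992.modes N},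
    ‖Yoshida1992.fourierCoeff a n ψ‖ / (2 * a) with hT
  set T' : ℕ → ℝ := fun N ↦ ∑' n : {n // n ∉ Yoshida1992.modes N},
    ‖Yoshida1992.fourierCoeff a n (deriv ψ)‖ / (2 * a) with hT'
  have hTlim : Tendsto T atTop (𝓝 0) := Yoshida1992.tendsto_tsum_compl_modes a ψ
  have hT'lim : Tendsto T' atTop (𝓝 0) := Yoshida1992.tendsto_tsum_compl_modes a (deriv ψ)
  set D : ℕ → ℝ := fun N ↦ (T N * (2 * a)) ^ 2 + (T N + T N + T' N * (2 * a)) ^ 2 with hD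
  have hDlim : Tendsto D atTop (𝓝 0) := by
    have h := ((hTlim.mul_const (2 * a)).pow 2).add
      (((hTlim.add hTlim).add (hT'lim.mul_const (2 * a))).pow 2)
    simpa using h
  -- the fixed weight integral
  set J : ℝ≥0∞ := ∫⁻ t : ℝ, ENNReal.ofReal ((1 + Real.log (1 + t ^ 2)) / (1 + t ^ 2)) with hJ
  have hJ' : J ≠ ∞ := lintegral_logW_div_lt_top.ne
  have hlim : Tendsto (fun N ↦ ENNReal.ofReal (D N) * J) atTop (𝓝 0) := by
    have h := ENNReal.Tendsto.mul_const (ENNReal.tendsto_ofReal hDlim) (Or.inr hJ')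
    simpa using h
  obtain ⟨N, hN⟩ := ((tendsto_order.1 hlim).2 δ hδ).exists
  refine ⟨N, lt_of_le_of_lt ?_ hN⟩
  -- pointwise decay of the truncation error by one partial integration
  set g : ℝ → ℂ := fun x ↦ ψ x - Yoshida1992.trigPoly a N ψ x with hg
  set g' : ℝ → ℂ := fun x ↦ deriv ψ x - Yoshida1992.trigPolyDeriv a N ψ x with hg'
  have hgd : ∀ x, HasDerivAt g (g' x) x := fun x ↦
    (((hsm.differentiable (by simp)).differentiableAt).hasDerivAt).sub
      (Yoshida1992.hasDerivAt_trigPoly a N ψ x)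
  have hder_eq : Yoshida1992.trigPolyDeriv a N ψ = Yoshida1992.trigPoly a N (deriv ψ) :=
    funext fun x ↦ trigPolyDeriv_eq_trigPoly_deriv ha hψC N x
  have hg'c : Continuous g' := by
    rw [hg', hder_eq]
    exact (hsm.continuous_deriv (by simp)).sub
      (continuous_iff_continuousAt.2 fun x ↦
        (Yoshida1992.hasDerivAt_trigPoly a N (deriv ψ) x).continuousAt)
  have h0 : ∀ x ∈ Icc (-a) a, ‖g x‖ ≤ T N := fun x hx ↦
    Yoshida1992.norm_sub_trigPoly_le ha hK N hx
  have h1 : ∀ x ∈ Icc (-a) a, ‖g' x‖ ≤ T' N := fun x hx ↦ by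
    rw [hg']
    simp only [hder_eq]
    exact Yoshida1992.norm_sub_trigPoly_le ha hK' N hx
  have hpt : ∀ t : ℝ, ‖weilMellin (ψ - Yoshida1992.proj a N ψ) (1 / 2 + t * I)‖ ^ 2 *
      (1 + Real.log (1 + t ^ 2)) ≤ D N * ((1 + Real.log (1 + t ^ 2)) / (1 + t ^ 2)) := by
    intro t
    have ht : (0 : ℝ) < 1 + t ^ 2 := by nlinarith [sq_nonneg t]
    have hw := logW_nonneg t
    have hdec := norm_sq_weilMellin_indicator_mul_le ha hgd hg'c h0 h1 t
    rw [sub_proj_eq_indicator ha hψC N]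
    have hsq : ‖weilMellin ((Icc (-a) a).indicator g) (1 / 2 + t * I)‖ ^ 2 ≤ D N / (1 + t ^ 2) := by
      rw [le_div_iff₀ ht]; exact hdec
    calc ‖weilMellin ((Icc (-a) a).indicator g) (1 / 2 + t * I)‖ ^ 2 * (1 + Real.log (1 + t ^ 2))
        ≤ D N / (1 + t ^ 2) * (1 + Real.log (1 + t ^ 2)) := mul_le_mul_of_nonneg_right hsq hw
      _ = D N * ((1 + Real.log (1 + t ^ 2)) / (1 + t ^ 2)) := by ring
  have hDN : 0 ≤ D N := by positivity
  unfold logSobolevEnergy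
  calc ∫⁻ s : ℝ, ENNReal.ofReal (‖weilMellin (ψ - Yoshida1992.proj a N ψ) (1 / 2 + s * I)‖ ^ 2 *
        (1 + Real.log (1 + s ^ 2)))
      ≤ ∫⁻ s : ℝ, ENNReal.ofReal (D N * ((1 + Real.log (1 + s ^ 2)) / (1 + s ^ 2))) :=
        lintegral_mono fun s ↦ ENNReal.ofReal_le_ofReal (hpt s)
    _ = ENNReal.ofReal (D N) * J := by
        rw [hJ, ← lintegral_const_mul' _ _ ENNReal.ofReal_ne_top]
        refine lintegral_congr fun s ↦ ?_
        rw [ENNReal.ofReal_mul hDN]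

end Truncation

/-! ## §C Step (2.18): mollification into `C_c^∞((−a, a))` -/

section Mollification

variable {a : ℝ}

open WeilContinuous in
/-- **Step (2.18)**: a window function `ξ₁` supported in a SMALLER window `[−b, b]`, `b < a`, with
finite energy is approximated in the weighted norm by the smooth functions `η_n = φ_n ∗ ξ₁`
(`φ_n` the mollifiers), which for `n` large are supported inside `[−a, a]`:
`η̂_n(s) = φ̂_n(s) ξ̂₁(s)`, `|φ̂_n| ≤ 1`, `φ̂_n → 1` pointwise, and dominated convergence.
[cite: ConnesConsani2023, proof of Lemma 2.2, eq. (2.18) «quadratsemi5», p. 105 (arXiv chunk p0007:L52–L56)] -/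
theorem exists_mem_C_logSobolevEnergy_sub_lt {b : ℝ} (hb : b < a) {ξ : ℝ → ℂ}
    (hξ : MemLp ξ 2 volume) (hsupp : Function.support ξ ⊆ Icc (-b) b)
    (hE : logSobolevEnergy ξ < ∞) {δ : ℝ≥0∞} (hδ : 0 < δ) :
    ∃ η : ℝ → ℂ, η ∈ Yoshida1992.C a ∧ logSobolevEnergy (ξ - η) < δ := by
  have hint : Integrable ξ := integrable_of_memLp_window hξ hsupp
  have hcs : HasCompactSupport ξ := HasCompactSupport.of_support_subset_isCompact isCompact_Icc hsupp
  have hts : tsupport ξ ⊆ Icc (-b) b := closure_minimal hsupp isClosed_Icc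
  -- the mollified functions
  set η : ℕ → ℝ → ℂ := fun k ↦ weilConv ξ (moll k) with hη
  have hηtest : ∀ k, IsWeilTest (η k) := fun k ↦ by
    show IsWeilTest (weilConv ξ (moll k))
    rw [weilConv_eq_convolution_real]
    exact ⟨(hasCompactSupport_moll k).contDiff_convolution_right (ContinuousLinearMap.mul ℝ ℂ)
        hint.locallyIntegrable (contDiff_moll k),
      hcs.convolution (L := ContinuousLinearMap.mul ℝ ℂ) (hasCompactSupport_moll k)⟩
  have hηsupp : ∀ k, tsupport (η k) ⊆ Icc (-(b + (bump k).rOut)) (b + (bump k).rOut) := by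
    intro k
    refine (tsupport_weilConv_subset hcs).trans ?_
    rintro x ⟨u, hu, v, hv, rfl⟩
    have hu' := hts hu
    have hv' := WeilSquareMollifier.tsupport_moll_subset k hv
    simp only [mem_Icc] at hu' hv' ⊢
    constructor <;> linarith [hu'.1, hu'.2, hv'.1, hv'.2]
  -- a common window `[−(|b|+1), |b|+1]` for `ξ` and all `η k`
  have hsupp' : Function.support ξ ⊆ Icc (-(|b| + 1)) (|b| + 1) :=
    hsupp.trans (Icc_subset_Icc (by linarith [le_abs_self b]) (by linarith [le_abs_self b]))
  have hηsupp' : ∀ k, Function.support (η k) ⊆ Icc (-(|b| + 1)) (|b| + 1) := fun k ↦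
    (subset_tsupport _).trans ((hηsupp k).trans (Icc_subset_Icc
      (by linarith [neg_abs_le b, bump_rOut_le_one k, le_abs_self b])
      (by linarith [le_abs_self b, bump_rOut_le_one k])))
  have hηm : ∀ k, MemLp (η k) 2 volume := fun k ↦
    (hηtest k).1.continuous.memLp_of_hasCompactSupport (hηtest k).2
  -- the transform of the difference: `ξ̂ (1 − φ̂_k)`
  have hdiff : ∀ (k : ℕ) (t : ℝ), weilMellin (ξ - η k) (1 / 2 + t * I) =
      weilMellin ξ (1 / 2 + t * I) * (1 - weilMellin (moll k) (1 / 2 + t * I)) := by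
    intro k t
    rw [show ξ - η k = fun x ↦ ξ x - η k x from rfl,
      weilMellin_sub_window hξ hsupp' (hηm k) (hηsupp' k)]
    show weilMellin ξ (1 / 2 + t * I) - weilMellin (weilConv ξ (moll k)) (1 / 2 + t * I) = _
    rw [Yoshida1992.weilMellin_weilConv_half_line hint
      ((continuous_moll k).integrable_of_hasCompactSupport (hasCompactSupport_moll k))]
    ring
  -- dominated convergence for the energies
  set F : ℕ → ℝ → ℝ≥0∞ := fun k t ↦ ENNReal.ofReal
    (‖weilMellin (ξ - η k) (1 / 2 + t * I)‖ ^ 2 * (1 + Real.log (1 + t ^ 2))) with hF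
  set bound : ℝ → ℝ≥0∞ := fun t ↦ ENNReal.ofReal
    (4 * (‖weilMellin ξ (1 / 2 + t * I)‖ ^ 2 * (1 + Real.log (1 + t ^ 2)))) with hbound
  have hFmeas : ∀ k, AEMeasurable (F k) volume := by
    intro k
    have hi : Integrable (ξ - η k) := integrable_of_memLp_window (hξ.sub (hηm k))
      (support_sub_subset_window hsupp' (hηsupp' k))
    exact (((continuous_weilMellin_half_line_of_integrable hi).norm.pow 2).measurable.mul
      measurable_logW).ennreal_ofReal.aemeasurable
  have hFle : ∀ k, F k ≤ᵐ[volume] bound := by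
    intro k
    refine Eventually.of_forall fun t ↦ ENNReal.ofReal_le_ofReal ?_
    rw [hdiff k t, norm_mul, mul_pow]
    have h1 : ‖1 - weilMellin (moll k) (1 / 2 + t * I)‖ ≤ 2 := by
      calc ‖1 - weilMellin (moll k) (1 / 2 + t * I)‖
          ≤ ‖(1 : ℂ)‖ + ‖weilMellin (moll k) (1 / 2 + t * I)‖ := norm_sub_le _ _
        _ ≤ 1 + 1 := by rw [norm_one]; exact add_le_add le_rfl (norm_weilMellin_moll_half_le k t)
        _ = 2 := by norm_num
    have h2 : ‖1 - weilMellin (moll k) (1 / 2 + t * I)‖ ^ 2 ≤ 4 := by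
      nlinarith [norm_nonneg (1 - weilMellin (moll k) (1 / 2 + t * I))]
    have hw := logW_nonneg t
    have hn := sq_nonneg ‖weilMellin ξ (1 / 2 + t * I)‖
    nlinarith [mul_nonneg hn hw]
  have hfin : ∫⁻ t, bound t ≠ ∞ := by
    have e : ∫⁻ t, bound t = 4 * logSobolevEnergy ξ := by
      rw [hbound, logSobolevEnergy, ← lintegral_const_mul' _ _ (by norm_num)]
      refine lintegral_congr fun t ↦ ?_
      rw [ENNReal.ofReal_mul (by norm_num), show ENNReal.ofReal 4 = 4 by norm_num]
    rw [e]
    exact ENNReal.mul_ne_top (by norm_num) hE.ne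
  have hlim : ∀ᵐ t ∂volume, Tendsto (fun k ↦ F k t) atTop (𝓝 ((fun _ ↦ (0 : ℝ≥0∞)) t)) := by
    refine Eventually.of_forall fun t ↦ ?_
    have h1 : Tendsto (fun k ↦ weilMellin ξ (1 / 2 + t * I) *
        (1 - weilMellin (moll k) (1 / 2 + t * I))) atTop (𝓝 0) := by
      have h := ((tendsto_const_nhds (x := (1 : ℂ))).sub
        (tendsto_weilMellin_moll (1 / 2 + t * I))).const_mul (weilMellin ξ (1 / 2 + t * I))
      simpa using h
    have h2 : Tendsto (fun k ↦ ‖weilMellin (ξ - η k) (1 / 2 + t * I)‖ ^ 2 *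
        (1 + Real.log (1 + t ^ 2))) atTop (𝓝 0) := by
      have h := ((h1.norm).pow 2).mul_const (1 + Real.log (1 + t ^ 2))
      simp only [norm_zero, ne_eq, OfNat.ofNat_ne_zero, not_false_eq_true, zero_pow, zero_mul] at h
      refine h.congr fun k ↦ ?_
      rw [hdiff k t]
    have h3 := ENNReal.tendsto_ofReal h2
    rw [ENNReal.ofReal_zero] at h3
    exact h3
  have hconv := tendsto_lintegral_of_dominated_convergence' bound hFmeas hFle hfin hlim
  rw [lintegral_zero] at hconv
  -- choose `k` with small energy AND support inside the window
  have hev1 : ∀ᶠ k in atTop, ∫⁻ t, F k t < δ := (tendsto_order.1 hconv).2 δ hδ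
  have hev2 : ∀ᶠ k in atTop, (bump k).rOut < a - b :=
    (tendsto_order.1 tendsto_bump_rOut).2 (a - b) (by linarith)
  obtain ⟨k, hk1, hk2⟩ := (hev1.and hev2).exists
  refine ⟨η k, ?_, ?_⟩
  · rw [Yoshida1992.mem_C]
    exact ⟨hηtest k, (hηsupp k).trans (Icc_subset_Icc (by linarith) (by linarith))⟩
  · exact hk1

end Mollification

/-! ## §D Step (2.17): dilation `ξ₁(x) = ρ ξ(ρx)` and norm-continuity of the scaling action -/

section Dilation

variable {a : ℝ}

/-- Change of variables on the line for the lower integral: `∫ G(c t) dt = |c|⁻¹ ∫ G`. [folklore] -/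
private theorem lintegral_comp_mul_left' (G : ℝ → ℝ≥0∞) {c : ℝ} (hc : c ≠ 0) :
    ∫⁻ t, G (c * t) = ENNReal.ofReal |c⁻¹| * ∫⁻ t, G t := by
  calc ∫⁻ t, G (c * t) = ∫⁻ t, G t ∂(Measure.map (c * ·) volume) :=
        (lintegral_map_equiv G (Homeomorph.mulLeft₀ c hc).toMeasurableEquiv).symm
    _ = ENNReal.ofReal |c⁻¹| * ∫⁻ t, G t := by
        rw [Real.map_volume_mul_left hc, lintegral_smul_measure, smul_eq_mul]

/-- **The transform of the dilation**: for `ξ₁(x) = ρ ξ(ρx)` (`ρ > 0`), `ξ̂₁(s) = ξ̂(s/ρ)`.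
[cite: ConnesConsani2023, proof of Lemma 2.2 (2.17): "ξ̂₁(s) = ξ̂(ρ⁻¹s)", p. 105 (arXiv chunk p0007:L45)] -/
theorem weilMellin_dilate {ρ : ℝ} (hρ : 0 < ρ) (ξ : ℝ → ℂ) (t : ℝ) :
    weilMellin (fun x ↦ (ρ : ℂ) * ξ (ρ * x)) (1 / 2 + t * I) =
      weilMellin ξ (1 / 2 + ((t / ρ : ℝ) : ℂ) * I) := by
  unfold weilMellin
  set G : ℝ → ℂ := fun y ↦ ξ y * cexp ((1 / 2 + ((t / ρ : ℝ) : ℂ) * I - 1 / 2) * y) with hG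
  have hsub := MeasureTheory.Measure.integral_comp_mul_left G ρ
  have e : ∀ x : ℝ, (ρ : ℂ) * ξ (ρ * x) * cexp ((1 / 2 + (t : ℂ) * I - 1 / 2) * x) =
      (ρ : ℂ) * G (ρ * x) := by
    intro x
    rw [hG]
    simp only
    have hρ' : (ρ : ℂ) ≠ 0 := by exact_mod_cast hρ.ne'
    have : (1 / 2 + ((t / ρ : ℝ) : ℂ) * I - 1 / 2) * ((ρ * x : ℝ) : ℂ) =
        (1 / 2 + (t : ℂ) * I - 1 / 2) * x := by
      push_cast
      field_simp
      ring
    rw [this]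
    ring
  simp_rw [e]
  rw [integral_const_mul, hsub, abs_of_pos (inv_pos.2 hρ)]
  rw [show ((ρ : ℂ)) * (ρ⁻¹ • ∫ y, G y) = ((ρ * ρ⁻¹ : ℝ) : ℂ) * ∫ y, G y by
    rw [Complex.real_smul]; push_cast; ring]
  rw [mul_inv_cancel₀ hρ.ne']
  simp

/-- The dilation `ξ₁(x) = ρ ξ(ρx)` of a function supported in `[−a, a]` is supported in
`[−a/ρ, a/ρ]` (`ρ > 0`). [cite: ConnesConsani2023, proof of Lemma 2.2 (2.17): "the support of ξ₁ is contained in [−ρ⁻¹L/2, ρ⁻¹L/2]", p. 105 (arXiv chunk p0007:L52)] -/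
theorem support_dilate_subset {ρ : ℝ} (hρ : 0 < ρ) {ξ : ℝ → ℂ}
    (hsupp : Function.support ξ ⊆ Icc (-a) a) :
    Function.support (fun x ↦ (ρ : ℂ) * ξ (ρ * x)) ⊆ Icc (-(a / ρ)) (a / ρ) := by
  intro x hx
  rw [Function.mem_support] at hx
  have hx' : ξ (ρ * x) ≠ 0 := fun h ↦ hx (by rw [h, mul_zero])
  have hmem := hsupp (Function.mem_support.2 hx')
  rw [mem_Icc] at hmem ⊢
  constructor
  · rw [neg_le, le_div_iff₀ hρ]; nlinarith [hmem.1]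
  · rw [le_div_iff₀ hρ]; nlinarith [hmem.2]

/-- The dilation of an `L²` function is `L²`. [cite: ConnesConsani2023, proof of Lemma 2.2 (2.17) (ξ₁ ∈ L²), p. 105 (arXiv chunk p0007:L45)] -/
theorem memLp_dilate {ρ : ℝ} (hρ : 0 < ρ) {ξ : ℝ → ℂ} (hξ : MemLp ξ 2 volume) :
    MemLp (fun x ↦ (ρ : ℂ) * ξ (ρ * x)) 2 volume := by
  have hq : Measure.QuasiMeasurePreserving (fun x : ℝ ↦ ρ * x) volume volume := by
    refine ⟨measurable_const_mul ρ, ?_⟩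
    rw [Real.map_volume_mul_left hρ.ne']
    exact Measure.smul_absolutelyContinuous
  have hmeas : AEStronglyMeasurable (fun x ↦ (ρ : ℂ) * ξ (ρ * x)) volume :=
    (hξ.1.comp_quasiMeasurePreserving hq).const_mul _
  rw [memLp_two_iff_integrable_sq_norm hmeas]
  have hi := (integrable_norm_sq_of_memLp hξ).comp_mul_left' hρ.ne'
  refine (hi.const_mul (ρ ^ 2)).congr (Eventually.of_forall fun x ↦ ?_)
  simp only [norm_mul, mul_pow, Complex.norm_real, Real.norm_eq_abs, sq_abs]

/-- **Norm continuity of the scaling action on the weighted space** (p. 105: "the scaling action `S`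
of `ℝ₊*` on the Hilbert space of functions on `ℝ` with the norm `‖f‖₁² = ∫|f(s)|²(1+log(1+s²))ds` is
pointwise norm continuous"): for a continuous `F` of finite weighted norm and `ρ_n → 1`,
`1 ≤ ρ_n ≤ 2`, `‖F − F(·/ρ_n)‖₁ → 0`.  Printed: uniform boundedness of `S(ρ)` near `1` + continuity on
the dense subspace `C_c`; here: the same uniform bound gives convergence of the norms
`‖F(·/ρ_n)‖₁ → ‖F‖₁` (dominated convergence after the substitution `t = ρ_n u`), and pointwise
convergence + convergence of norms ⇒ norm convergence (Fatou applied to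
`2|F|² + 2|F(·/ρ_n)|² − |F − F(·/ρ_n)|² ≥ 0`).
[cite: ConnesConsani2023, proof of Lemma 2.2, eq. (2.17) «quadratsemi4» and the paragraph after it, p. 105 (arXiv chunk p0007:L40–L52)] -/
theorem tendsto_lintegral_sub_dilate {F : ℝ → ℂ} (hF : Continuous F)
    (hE : ∫⁻ t, ENNReal.ofReal (‖F t‖ ^ 2 * (1 + Real.log (1 + t ^ 2))) < ∞)
    {ρ : ℕ → ℝ} (hρ1 : ∀ n, 1 ≤ ρ n) (hρ2 : ∀ n, ρ n ≤ 2) (hρ : Tendsto ρ atTop (𝓝 1)) :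
    Tendsto (fun n ↦ ∫⁻ t, ENNReal.ofReal
      (‖F t - F (t / ρ n)‖ ^ 2 * (1 + Real.log (1 + t ^ 2)))) atTop (𝓝 0) := by
  have hρ0 : ∀ n, 0 < ρ n := fun n ↦ lt_of_lt_of_le one_pos (hρ1 n)
  -- notation
  set w : ℝ → ℝ := fun t ↦ 1 + Real.log (1 + t ^ 2) with hw
  have hw0 : ∀ t, 0 ≤ w t := fun t ↦ logW_nonneg t
  have hwc : Continuous w := continuous_logW
  set A : ℝ≥0∞ := ∫⁻ t, ENNReal.ofReal (‖F t‖ ^ 2 * w t) with hA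
  have hAtop : A ≠ ∞ := hE.ne
  have h4eq : ∫⁻ s, ENNReal.ofReal (4 * (‖F s‖ ^ 2 * w s)) = 4 * A := by
    rw [hA, ← lintegral_const_mul' _ _ (by norm_num)]
    refine lintegral_congr fun s ↦ ?_
    rw [ENNReal.ofReal_mul (by norm_num), show ENNReal.ofReal 4 = 4 by norm_num]
  set G : ℕ → ℝ → ℂ := fun n t ↦ F (t / ρ n) with hG
  set u : ℕ → ℝ → ℝ≥0∞ := fun n t ↦ ENNReal.ofReal (‖F t - G n t‖ ^ 2 * w t) with hu
  set v : ℕ → ℝ → ℝ≥0∞ := fun n t ↦ ENNReal.ofReal ((2 * ‖F t‖ ^ 2 + 2 * ‖G n t‖ ^ 2) * w t)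
    with hv
  set d : ℕ → ℝ → ℝ≥0∞ := fun n t ↦
    ENNReal.ofReal ((2 * ‖F t‖ ^ 2 + 2 * ‖G n t‖ ^ 2 - ‖F t - G n t‖ ^ 2) * w t) with hd
  show Tendsto (fun n ↦ ∫⁻ t, u n t) atTop (𝓝 0)
  -- continuity / measurability
  have hGc : ∀ n, Continuous (G n) := fun n ↦ hF.comp (continuous_id.div_const _)
  have hum : ∀ n, Measurable (u n) := fun n ↦
    ((((hF.sub (hGc n)).norm.pow 2).mul hwc).measurable).ennreal_ofReal
  have hvm : ∀ n, Measurable (v n) := fun n ↦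
    ((((continuous_const.mul (hF.norm.pow 2)).add
      (continuous_const.mul ((hGc n).norm.pow 2))).mul hwc).measurable).ennreal_ofReal
  have hdm : ∀ n, Measurable (d n) := fun n ↦
    (((((continuous_const.mul (hF.norm.pow 2)).add
      (continuous_const.mul ((hGc n).norm.pow 2))).sub ((hF.sub (hGc n)).norm.pow 2)).mul
        hwc).measurable).ennreal_ofReal
  -- pointwise algebra: `d + u = v`, `u ≤ v`
  have hpar : ∀ n t, ‖F t - G n t‖ ^ 2 ≤ 2 * ‖F t‖ ^ 2 + 2 * ‖G n t‖ ^ 2 := by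
    intro n t
    have h1 : ‖F t - G n t‖ ≤ ‖F t‖ + ‖G n t‖ := norm_sub_le _ _
    nlinarith [norm_nonneg (F t - G n t), norm_nonneg (F t), norm_nonneg (G n t),
      sq_nonneg (‖F t‖ - ‖G n t‖)]
  have hdu : ∀ n t, d n t + u n t = v n t := by
    intro n t
    simp only [hd, hu, hv]
    rw [← ENNReal.ofReal_add (mul_nonneg (by linarith [hpar n t]) (hw0 t))
      (mul_nonneg (sq_nonneg _) (hw0 t))]
    congr 1
    ring
  have huv : ∀ n t, u n t ≤ v n t := fun n t ↦ by
    rw [← hdu n t]; exact le_add_self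
  -- (i) convergence of the norms: `∫ v n → 4A`
  have hB : Tendsto (fun n ↦ ∫⁻ t, ENNReal.ofReal (‖G n t‖ ^ 2 * w t)) atTop (𝓝 A) := by
    -- substitution `t = ρ u`
    have hsubst : ∀ n, ∫⁻ t, ENNReal.ofReal (‖G n t‖ ^ 2 * w t) =
        ENNReal.ofReal (ρ n) * ∫⁻ s, ENNReal.ofReal (‖F s‖ ^ 2 * w (ρ n * s)) := by
      intro n
      have h := lintegral_comp_mul_left' (fun s ↦ ENNReal.ofReal (‖F s‖ ^ 2 * w (ρ n * s)))
        (inv_ne_zero (hρ0 n).ne')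
      rw [inv_inv, abs_of_pos (hρ0 n)] at h
      rw [← h]
      refine lintegral_congr fun t ↦ ?_
      simp only [hG]
      rw [show t / ρ n = (ρ n)⁻¹ * t by rw [div_eq_inv_mul], ← mul_assoc,
        mul_inv_cancel₀ (hρ0 n).ne', one_mul]
    simp_rw [hsubst]
    -- dominated convergence for the inner integrals
    have hinner : Tendsto (fun n ↦ ∫⁻ s, ENNReal.ofReal (‖F s‖ ^ 2 * w (ρ n * s))) atTop
        (𝓝 A) := by
      refine tendsto_lintegral_of_dominated_convergence'
        (fun s ↦ ENNReal.ofReal (4 * (‖F s‖ ^ 2 * w s))) (fun n ↦ ?_) (fun n ↦ ?_) ?_ ?_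
      · exact (((hF.norm.pow 2).mul (hwc.comp (continuous_const.mul continuous_id))).measurable
          ).ennreal_ofReal.aemeasurable
      · refine Eventually.of_forall fun s ↦ ENNReal.ofReal_le_ofReal ?_
        have h := logW_mul_le (hρ0 n).le (hρ2 n) s
        have hn := sq_nonneg ‖F s‖
        calc ‖F s‖ ^ 2 * w (ρ n * s) ≤ ‖F s‖ ^ 2 * (4 * w s) := mul_le_mul_of_nonneg_left h hn
          _ = 4 * (‖F s‖ ^ 2 * w s) := by ring
      · rw [h4eq]
        exact ENNReal.mul_ne_top (by norm_num) hAtop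
      · refine Eventually.of_forall fun s ↦ ?_
        refine ENNReal.tendsto_ofReal (Tendsto.const_mul _ ?_)
        have h1 : Tendsto (fun n ↦ ρ n * s) atTop (𝓝 (1 * s)) := hρ.mul_const s
        rw [one_mul] at h1
        exact (hwc.tendsto s).comp h1
    have hone : Tendsto (fun n ↦ ENNReal.ofReal (ρ n)) atTop (𝓝 1) := by
      have h := ENNReal.tendsto_ofReal hρ
      rwa [ENNReal.ofReal_one] at h
    have h := ENNReal.Tendsto.mul hone (Or.inl one_ne_zero) hinner (Or.inr ENNReal.one_ne_top)
    rwa [one_mul] at h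
  have hm2 : Measurable (fun t : ℝ ↦ 2 * ENNReal.ofReal (‖F t‖ ^ 2 * w t)) :=
    (((hF.norm.pow 2).mul hwc).measurable.ennreal_ofReal).const_mul _
  have hVeq : ∀ n, ∫⁻ t, v n t = 2 * A + 2 * ∫⁻ t, ENNReal.ofReal (‖G n t‖ ^ 2 * w t) := by
    intro n
    rw [hA, ← lintegral_const_mul' _ _ (by norm_num), ← lintegral_const_mul' _ _ (by norm_num),
      ← lintegral_add_left hm2]
    refine lintegral_congr fun t ↦ ?_
    simp only [hv]
    rw [show (2 : ℝ≥0∞) = ENNReal.ofReal 2 by norm_num, ← ENNReal.ofReal_mul zero_le_two,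
      ← ENNReal.ofReal_mul zero_le_two,
      ← ENNReal.ofReal_add (mul_nonneg zero_le_two (mul_nonneg (sq_nonneg _) (hw0 t)))
        (mul_nonneg zero_le_two (mul_nonneg (sq_nonneg _) (hw0 t)))]
    congr 1
    ring
  have hV : Tendsto (fun n ↦ ∫⁻ t, v n t) atTop (𝓝 (2 * A + 2 * A)) := by
    simp_rw [hVeq]
    exact tendsto_const_nhds.add (ENNReal.Tendsto.const_mul hB (Or.inr (by norm_num)))
  -- (ii) pointwise convergence `G n t → F t`, hence `d n t → 4|F t|² w t`
  have hGlim : ∀ t, Tendsto (fun n ↦ G n t) atTop (𝓝 (F t)) := by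
    intro t
    have h1 : Tendsto (fun n ↦ t / ρ n) atTop (𝓝 (t / 1)) :=
      tendsto_const_nhds.div hρ one_ne_zero
    rw [div_one] at h1
    exact (hF.tendsto t).comp h1
  have hdlim : ∀ t, Tendsto (fun n ↦ d n t) atTop (𝓝 (ENNReal.ofReal (4 * (‖F t‖ ^ 2 * w t)))) := by
    intro t
    have h1 := hGlim t
    have h2 : Tendsto (fun n ↦ F t - G n t) atTop (𝓝 0) := by
      have := (tendsto_const_nhds (x := F t)).sub h1
      rwa [sub_self] at this
    have h3 : Tendsto (fun n ↦ (2 * ‖F t‖ ^ 2 + 2 * ‖G n t‖ ^ 2 - ‖F t - G n t‖ ^ 2) * w t)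
        atTop (𝓝 ((2 * ‖F t‖ ^ 2 + 2 * ‖F t‖ ^ 2 - ‖(0 : ℂ)‖ ^ 2) * w t)) :=
      ((tendsto_const_nhds.add ((h1.norm.pow 2).const_mul 2)).sub (h2.norm.pow 2)).mul_const _
    have e : (2 * ‖F t‖ ^ 2 + 2 * ‖F t‖ ^ 2 - ‖(0 : ℂ)‖ ^ 2) * w t = 4 * (‖F t‖ ^ 2 * w t) := by
      rw [norm_zero]; ring
    rw [e] at h3
    exact ENNReal.tendsto_ofReal h3
  -- (iii) Fatou
  have hFatou : 4 * A ≤ liminf (fun n ↦ ∫⁻ t, d n t) atTop := by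
    rw [← h4eq]
    calc ∫⁻ t, ENNReal.ofReal (4 * (‖F t‖ ^ 2 * w t))
        = ∫⁻ t, liminf (fun n ↦ d n t) atTop := lintegral_congr fun t ↦ (hdlim t).liminf_eq.symm
      _ ≤ liminf (fun n ↦ ∫⁻ t, d n t) atTop := lintegral_liminf_le' fun n ↦ (hdm n).aemeasurable
  have hsum : ∀ n, (∫⁻ t, d n t) + ∫⁻ t, u n t = ∫⁻ t, v n t := by
    intro n
    rw [← lintegral_add_left (hdm n)]
    exact lintegral_congr fun t ↦ hdu n t
  have hVfin : ∀ n, ∫⁻ t, v n t ≠ ∞ := by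
    intro n
    have h1 := hVeq n
    -- the dilated energy is finite by the uniform bound `w(ρ t) ≤ 4 w(t)`
    have h2 : ∫⁻ t, ENNReal.ofReal (‖G n t‖ ^ 2 * w t) ≤ ENNReal.ofReal (ρ n) * (4 * A) := by
      have h := lintegral_comp_mul_left' (fun s ↦ ENNReal.ofReal (‖F s‖ ^ 2 * w (ρ n * s)))
        (inv_ne_zero (hρ0 n).ne')
      rw [inv_inv, abs_of_pos (hρ0 n)] at h
      have e1 : ∫⁻ t, ENNReal.ofReal (‖G n t‖ ^ 2 * w t) =
          ∫⁻ t, ENNReal.ofReal (‖F ((ρ n)⁻¹ * t)‖ ^ 2 * w (ρ n * ((ρ n)⁻¹ * t))) := by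
        refine lintegral_congr fun t ↦ ?_
        simp only [hG]
        rw [show t / ρ n = (ρ n)⁻¹ * t by rw [div_eq_inv_mul], ← mul_assoc,
          mul_inv_cancel₀ (hρ0 n).ne', one_mul]
      have hle : ∫⁻ s, ENNReal.ofReal (‖F s‖ ^ 2 * w (ρ n * s)) ≤ 4 * A := by
        rw [← h4eq]
        refine lintegral_mono fun s ↦ ENNReal.ofReal_le_ofReal ?_
        have hl := logW_mul_le (hρ0 n).le (hρ2 n) s
        have hn := sq_nonneg ‖F s‖
        calc ‖F s‖ ^ 2 * w (ρ n * s) ≤ ‖F s‖ ^ 2 * (4 * w s) := mul_le_mul_of_nonneg_left hl hn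
          _ = 4 * (‖F s‖ ^ 2 * w s) := by ring
      rw [e1, h]
      gcongr
    rw [h1]
    refine ENNReal.add_ne_top.2 ⟨ENNReal.mul_ne_top (by norm_num) hAtop, ENNReal.mul_ne_top
      (by norm_num) (ne_top_of_le_ne_top ?_ h2)⟩
    exact ENNReal.mul_ne_top ENNReal.ofReal_ne_top (ENNReal.mul_ne_top (by norm_num) hAtop)
  -- the ε-argument
  rw [ENNReal.tendsto_nhds_zero]
  intro ε hε
  have hε2 : 0 < ε / 2 := ENNReal.half_pos hε.ne'
  have h4A : 2 * A + 2 * A = 4 * A := by rw [← add_mul]; norm_num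
  have hA4 : 4 * A ≠ ∞ := ENNReal.mul_ne_top (by norm_num) hAtop
  rw [h4A] at hV
  have hVev : ∀ᶠ n in atTop, ∫⁻ t, v n t ≤ 4 * A + ε / 2 :=
    (((ENNReal.tendsto_nhds hA4).1 hV) (ε / 2) hε2).mono fun n hn ↦ hn.2
  by_cases hcase : 4 * A ≤ ε / 2
  · filter_upwards [hVev] with n hn
    calc ∫⁻ t, u n t ≤ ∫⁻ t, v n t := lintegral_mono fun t ↦ huv n t
      _ ≤ 4 * A + ε / 2 := hn
      _ ≤ ε / 2 + ε / 2 := add_le_add hcase le_rfl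
      _ = ε := ENNReal.add_halves ε
  · rw [not_le] at hcase
    have hc : 4 * A - ε / 2 < liminf (fun n ↦ ∫⁻ t, d n t) atTop :=
      lt_of_lt_of_le (ENNReal.sub_lt_self hA4 (ne_of_gt (lt_trans hε2 hcase)) hε2.ne') hFatou
    have hDev : ∀ᶠ n in atTop, 4 * A - ε / 2 < ∫⁻ t, d n t := eventually_lt_of_lt_liminf hc
    filter_upwards [hVev, hDev] with n hVn hDn
    have hDfin : ∫⁻ t, d n t ≠ ∞ :=
      ne_top_of_le_ne_top (hVfin n) (by rw [← hsum n]; exact le_self_add)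
    have hU : ∫⁻ t, u n t = (∫⁻ t, v n t) - ∫⁻ t, d n t :=
      ENNReal.eq_sub_of_add_eq hDfin (by rw [add_comm]; exact hsum n)
    rw [hU]
    calc (∫⁻ t, v n t) - ∫⁻ t, d n t ≤ (4 * A + ε / 2) - (4 * A - ε / 2) := tsub_le_tsub hVn hDn.le
      _ ≤ ε := by
          rw [tsub_le_iff_right]
          have key : 4 * A + ε / 2 = ε + (4 * A - ε / 2) := by
            calc 4 * A + ε / 2 = (ε / 2 + (4 * A - ε / 2)) + ε / 2 := by
                  rw [add_tsub_cancel_of_le hcase.le]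
              _ = (ε / 2 + ε / 2) + (4 * A - ε / 2) := by ring
              _ = ε + (4 * A - ε / 2) := by rw [ENNReal.add_halves]
          exact key.le

/-- **Step (2.17)**: for `ξ` in the form domain of the window `[−a, a]` and `δ > 0` there is `ρ ∈ (1, 2]`
with `‖ξ̂ − ξ̂₁‖₁² < δ`, `ξ₁(x) = ρ ξ(ρx)` (supported in the smaller window `[−a/ρ, a/ρ]`).
[cite: ConnesConsani2023, proof of Lemma 2.2, eq. (2.17) «quadratsemi4», p. 105 (arXiv chunk p0007:L40–L52)] -/
theorem exists_dilate_logSobolevEnergy_sub_lt (ha : 0 < a) {ξ : ℝ → ℂ} (hξ : ξ ∈ formDomain a)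
    {δ : ℝ≥0∞} (hδ : 0 < δ) :
    ∃ ρ : ℝ, 1 < ρ ∧ ρ ≤ 2 ∧ logSobolevEnergy (ξ - fun x ↦ (ρ : ℂ) * ξ (ρ * x)) < δ := by
  obtain ⟨hξm, hξs, hξE⟩ := hξ
  have hint : Integrable ξ := integrable_of_memLp_window hξm hξs
  set F : ℝ → ℂ := fun t ↦ weilMellin ξ (1 / 2 + t * I) with hFdef
  have hFc : Continuous F := continuous_weilMellin_half_line_of_integrable hint
  set ρ : ℕ → ℝ := fun n ↦ 1 + 1 / ((n : ℝ) + 1) with hρdef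
  have hρ1 : ∀ n, 1 ≤ ρ n := fun n ↦ by
    have : (0 : ℝ) ≤ 1 / ((n : ℝ) + 1) := by positivity
    simp only [hρdef]; linarith
  have hρ1' : ∀ n, 1 < ρ n := fun n ↦ by
    have : (0 : ℝ) < 1 / ((n : ℝ) + 1) := by positivity
    simp only [hρdef]; linarith
  have hρ2 : ∀ n, ρ n ≤ 2 := fun n ↦ by
    have : 1 / ((n : ℝ) + 1) ≤ 1 := by
      rw [div_le_one (by positivity)]; linarith [(Nat.cast_nonneg n : (0 : ℝ) ≤ n)]
    simp only [hρdef]; linarith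
  have hρ : Tendsto ρ atTop (𝓝 1) := by
    have h := (tendsto_const_nhds (x := (1 : ℝ))).add
      (tendsto_one_div_add_atTop_nhds_zero_nat (𝕜 := ℝ))
    rw [add_zero] at h
    exact h
  have hconv := tendsto_lintegral_sub_dilate hFc hξE hρ1 hρ2 hρ
  obtain ⟨n, hn⟩ := ((tendsto_order.1 hconv).2 δ hδ).exists
  refine ⟨ρ n, hρ1' n, hρ2 n, ?_⟩
  have hρ0 : 0 < ρ n := lt_trans one_pos (hρ1' n)
  -- the energy of the difference IS the integral of `tendsto_lintegral_sub_dilate`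
  have hds : Function.support (fun x ↦ (ρ n : ℂ) * ξ (ρ n * x)) ⊆ Icc (-a) a :=
    (support_dilate_subset hρ0 hξs).trans (Icc_subset_Icc
      (by rw [neg_le_neg_iff]; exact div_le_self ha.le (hρ1 n))
      (div_le_self ha.le (hρ1 n)))
  have hdm := memLp_dilate hρ0 hξm
  refine lt_of_le_of_lt (le_of_eq ?_) hn
  unfold logSobolevEnergy
  refine lintegral_congr fun t ↦ ?_
  rw [show (ξ - fun x ↦ (ρ n : ℂ) * ξ (ρ n * x)) = fun x ↦ ξ x - (ρ n : ℂ) * ξ (ρ n * x) from rfl,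
    weilMellin_sub_window hξm hξs hdm hds, weilMellin_dilate hρ0 ξ t]

end Dilation

/-! ## §E Assembly: Lemma 2.2 -/

section Assembly

variable {a : ℝ}

/-- A test function supported in the window is a window function (`L²`, support in `[−a, a]`).
[cite: ConnesConsani2023, proof of Prop. 2.1 ("all smooth functions with support in (λ⁻¹, λ)" lie in the domain), p. 103 (arXiv chunk p0006:L70)] -/
theorem memLp_and_support_of_mem_C {ψ : ℝ → ℂ} (hψ : ψ ∈ Yoshida1992.C a) :
    MemLp ψ 2 volume ∧ Function.support ψ ⊆ Icc (-a) a := by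
  rw [Yoshida1992.mem_C] at hψ
  exact ⟨hψ.1.1.continuous.memLp_of_hasCompactSupport hψ.1.2, (subset_tsupport ψ).trans hψ.2⟩

/-- **Lemma 2.2 (Connes–Consani, ζ-cycles), DISCHARGED**: the Laurent polynomials `ℂ[U, U⁻¹]` are a
core for `QW_λ` — in the reduced form (2.16) of the named fact `lemma_2_2`: every `ξ` in the form domain
of the window `[−a, a]` (`a = log λ > 0`) is approximated in the weighted norm
`‖ξ̂ − η̂‖₁² = ∫|ξ̂(s) − η̂(s)|²(1 + log(1 + s²))ds` by elements `η ∈ E_N = Yoshida1992.W a N`.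
Proof = the printed one: (2.17) dilation (§D), (2.18) mollification (§C), (2.19) Fourier truncation
(§B), combined with `‖f + g‖₁² ≤ 2‖f‖₁² + 2‖g‖₁²`.
[cite: ConnesConsani2023, Lemma 2.2 p. 104 and its proof pp. 104–105, eqs. (2.14)–(2.19) (arXiv:2106.01715 chunk p0006:L83–p0007:L67)] -/
theorem lemma_2_2_holds : lemma_2_2 := by
  intro a ha ξ hξ ε hε
  have hξ' := hξ
  obtain ⟨hξm, hξs, hξE⟩ := hξ'
  set e : ℝ≥0∞ := ENNReal.ofReal (ε / 16) with he
  have he0 : 0 < e := ENNReal.ofReal_pos.2 (by positivity)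
  -- (2.17) dilation
  obtain ⟨ρ, hρ1, hρ2, h1⟩ := exists_dilate_logSobolevEnergy_sub_lt ha hξ he0
  have hρ0 : 0 < ρ := lt_trans one_pos hρ1
  set ξ₁ : ℝ → ℂ := fun x ↦ (ρ : ℂ) * ξ (ρ * x) with hξ₁
  have hξ₁m : MemLp ξ₁ 2 volume := memLp_dilate hρ0 hξm
  have hξ₁s : Function.support ξ₁ ⊆ Icc (-(a / ρ)) (a / ρ) := support_dilate_subset hρ0 hξs
  have hb : a / ρ < a := div_lt_self ha hρ1
  have hξ₁s' : Function.support ξ₁ ⊆ Icc (-a) a :=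
    hξ₁s.trans (Icc_subset_Icc (by linarith) hb.le)
  have hξ₁E : logSobolevEnergy ξ₁ < ∞ := by
    have e1 : ξ₁ = ξ - (ξ - ξ₁) := by rw [sub_sub_cancel]
    have h := logSobolevEnergy_sub_le hξm hξs (hξm.sub hξ₁m) (support_sub_subset_window hξs hξ₁s')
    rw [← e1] at h
    refine lt_of_le_of_lt h (ENNReal.add_lt_top.2 ⟨ENNReal.mul_lt_top (by norm_num) hξE,
      ENNReal.mul_lt_top (by norm_num) (lt_trans h1 ENNReal.ofReal_lt_top)⟩)
  -- (2.18) mollification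
  obtain ⟨η, hηC, h2⟩ := exists_mem_C_logSobolevEnergy_sub_lt hb hξ₁m hξ₁s hξ₁E he0
  obtain ⟨hηm, hηs⟩ := memLp_and_support_of_mem_C hηC
  -- (2.19) truncation
  obtain ⟨N, h3⟩ := exists_logSobolevEnergy_sub_proj_lt ha hηC he0
  set P := Yoshida1992.proj a N η with hP
  obtain ⟨hPm, hPs, -⟩ := mem_formDomain_of_mem_W ha (Yoshida1992.proj_mem_W a N η)
  refine ⟨N, P, Yoshida1992.proj_mem_W a N η, ?_⟩
  -- assembly
  have hA : logSobolevEnergy (ξ - P) ≤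
      2 * logSobolevEnergy (ξ - ξ₁) + 2 * logSobolevEnergy (P - ξ₁) := by
    have h := logSobolevEnergy_sub_le (hξm.sub hξ₁m) (support_sub_subset_window hξs hξ₁s')
      (hPm.sub hξ₁m) (support_sub_subset_window hPs hξ₁s')
    rwa [sub_sub_sub_cancel_right] at h
  have hB : logSobolevEnergy (P - ξ₁) ≤
      2 * logSobolevEnergy (ξ₁ - η) + 2 * logSobolevEnergy (η - P) := by
    rw [logSobolevEnergy_sub_symm P ξ₁]
    have h := logSobolevEnergy_sub_le (hξ₁m.sub hηm) (support_sub_subset_window hξ₁s' hηs)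
      (hPm.sub hηm) (support_sub_subset_window hPs hηs)
    rwa [sub_sub_sub_cancel_right, logSobolevEnergy_sub_symm P η] at h
  have hB' : logSobolevEnergy (P - ξ₁) ≤ 2 * e + 2 * e := by
    refine hB.trans ?_
    gcongr
  have hC : logSobolevEnergy (ξ - P) ≤ 2 * e + 2 * (2 * e + 2 * e) := by
    refine hA.trans ?_
    gcongr
  refine lt_of_le_of_lt hC ?_
  have e10 : 2 * e + 2 * (2 * e + 2 * e) = ENNReal.ofReal (10 * (ε / 16)) := by
    rw [he, ENNReal.ofReal_mul (by norm_num), show ENNReal.ofReal 10 = 10 by norm_num]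
    ring
  rw [e10, ENNReal.ofReal_lt_ofReal_iff hε]
  linarith

end Assembly

end Literature.NumberTheory.ConnesConsani2023
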